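import Literature.NumberTheory.GaloisCohomology.Howard2004.DVRLevelTorsionControlProofs
import Literature.NumberTheory.GaloisCohomology.Howard2004.FiniteSingularTameAdmissible
import Literature.NumberTheory.GaloisRepresentations.ContinuousH1OpenKernelProofs
import HarnessLib

/-!
# Howard 2004, Lemma 1.5.1 / Lemma 1.3.3 AT LEVEL `n`: the transverse condition is cartesian along an
# injective morphism with trivial `Γ_L`-action; the one-step control for `F(n)` on a `DVRSetting`

Topic `NumberTheory/GaloisCohomology/Howard2004` (instantiation layer of Howard's Lemma 1.6.4 — the
residual Galois input of the print leaf G87 `Howard2004.thm161_dvrKolyvaginBound` = Thm. 1.6.1; cell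
`pub/bsd-print-x9`, seat `bsd-line-x10b-p1-w2` g15).  THEOREMS ONLY: no definition, no named fact, no
instance, no notation, no `sorry`.  Sequel to `DVRLevelTorsionControlProofs` (seat w2 g14: the one-step
cartesian identity `F_{k,v} = H¹(K_v, inc_k)⁻¹(F_{k+1,v})` at EVERY place for `F` itself, Selmer descent
and Lemma 1.3.3 for the levels `(k, k+1)`), extended to the MODIFIED structures `F(n)` of Def. 1.2.2
(`SelmerTriple.atLevel`: transverse at the primes of `n`).

Printed source.  B. Howard, *The Heegner point Kolyvagin system*, Compositio Math. **140** (2004)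
= arXiv:1202.6340.  Lemma 1.5.1 (arXiv 2.5.1, p. 9 L127–133): «The Selmer triple `(T, F(n), 𝓛(n))`
satisfies H.0–H.5 for any `n ∈ 𝓝`.  *Proof.* See Lemma 3.7.4 of [MR04] for the case of H.3. The other
cases are trivial.»  Used through Lemma 1.3.3 («H.5 application») AT LEVEL `n` in the proof of Lemma
1.6.4 (arXiv p. 12 L1–9: «Under the identification `H¹_{F(n)}(K,T^{(k)}) ≅ H¹_{F(n)}(K,T^{(2k-1)})[𝔪^k]`
of Lemma (H.5 application)»; «we identify `H¹_{F(n)}(K,T^{(k)})[𝔪] ≅ H¹_{F(n)}(K,T̄)`»).  At a prime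
`λ ∈ n ⊆ 𝓛^{(k)}` the local Galois group acts TRIVIALLY on the levels in play (`λ` unramified of degree
two with `Frob_λ ≡ 1 mod I_ℓ ⊆ 𝔪^k`), and the transverse condition is the kernel of the restriction
to `Γ_L ≤ Γ_{K_λ}` (`transverseCondition`); for such kernels «cartesian» is formal.

* §1 `oneCocycleClass_mem_transverseCondition_iff` — with `Γ_L` acting trivially, `[φ] ∈ H¹_tr` iff
  `φ` vanishes on `Γ_L`; **`comap_cohomologyMap_transverseCondition_eq`** — for an injective additive
  `Γ_{K_λ}`-equivariant `f : M₁ → M₂` with `Γ_L` acting trivially on `M₂`: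
  `H¹(K_λ, f)⁻¹(H¹_tr(K_λ, M₂)) = H¹_tr(K_λ, M₁)` (the transverse condition is cartesian along `f`).
* §2 on a `DVRSetting` with H.0–H.5, for a finite set `n ⊆ 𝓛` of primes at which `Γ_L` acts
  trivially on `T^{(k+1)}`: **`DVRSetting.comap_incLoc_atLevel_cond_eq`** — the one-step cartesian
  identity `F(n)_{k,v} = H¹(K_v, inc_k)⁻¹(F(n)_{k+1,v})` at EVERY place (off `n` it is w2 g14's (C));
  **`incH1_mem_selmerGroup_atLevel_iff`** (Selmer descent for `F(n)`) and
  **`exists_mem_selmerGroup_atLevel_incH1_eq_iff`** — LEMMA 1.3.3 AT LEVEL `n` for the levels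
  `(k, k+1)`: `H¹(K, inc_k)` identifies `H¹_{F(n)}(K, T^{(k)})` with the `𝔪^{e_k}`-torsion of
  `H¹_{F(n)}(K, T^{(k+1)})` (with w2 g14's (Z) `exists_incH1_eq_of_scalarMapH1_pow_eq_zero`, which is
  structure-independent).
* §3 (append) through several levels: `incH1LE_mem_selmerGroup_atLevel_iff`,
  **`exists_mem_selmerGroup_atLevel_incH1LE_eq`** (descent through `d` levels for `F(n)`: the
  reading «`H¹_{F(n)}(K,T^{(k)}) ≅ H¹_{F(n)}(K,T^{(2k-1)})[𝔪^k]`» of Lemma 1.6.3/1.6.4).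
* §4 (append) `toLocal_apply_eq_self_of_ker_eq_bot` / `…_of_levelIdeal_smul_eq_bot` /
  `htriv_of_levelIdeal_smul_eq_bot`: the trivial-action hypothesis DISCHARGED at the levels killed by
  `I_n` (H.0 + `w ∈ 𝓛` unramified; lit's `trivial_toLocal_of_mem_primes`).

HONEST FRAMING.  The triviality of the `Γ_L`-action at the primes of `n` is a hypothesis of §1–§3 (in print:
the standing `𝓛 ⊂ 𝓛_k(T)` of §1.5 / `n ∈ 𝓝^{(k)}` of §1.6), discharged in §4 at the levels killed by `I_n`; the statements are on `H¹(K, T^{(k)})` with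
`F(n)` (the presentations `T^{(k)}/I_nT^{(k)} = T^{(k)}` of `LevelData` are not unfolded here); Lemma
1.6.4 / Thm. 1.6.1 / `thm161_dvrKolyvaginBound` are NOT proved; no summit statement is proved; the
Birch–Swinnerton-Dyer conjecture is not proved by any of this.

References: [Howard2004HeegnerKolyvagin] Def. 1.2.2, Lemma 1.3.3, Lemma 1.5.1, Lemma 1.6.4 proof
(arXiv p. 6 L101–125, p. 7 L152–160, p. 9 L127–133, p. 12 L1–9); [MazurRubinMemoirs2004] Lemma
3.5.4, Lemma 3.7.4; [SerreGaloisCohomology1997] I §2.2, I §5.1.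
-/

set_option autoImplicit false

noncomputable section

open Function NumberField IsDedekindDomain Field
open scoped NumberField ContRepresentation Pointwise

namespace Literature.NumberTheory.GaloisCohomology.Howard2004

open CategoryTheory
open Literature.NumberTheory.GaloisRepresentations
open Literature.NumberTheory.GaloisRepresentations.DiscreteGaloisModule

/-! ## §1 The transverse condition is cartesian along an injective map with trivial `Γ_L`-action -/

section Transverse

variable {p : ℕ} [Fact p.Prime] {K : Type} [Field K] [NumberField K]
  {M₁ : Type} [AddCommGroup M₁] [TopologicalSpace M₁] [DiscreteTopology M₁]
  {M₂ : Type} [AddCommGroup M₂] [TopologicalSpace M₂] [DiscreteTopology M₂]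

/-- **`[φ] ∈ H¹_tr(K_λ, M)` iff `φ` vanishes on `Γ_L`**, when `Γ_L` (`transverseFixer`) acts trivially
on `M` (a class restricts to zero on a subgroup iff a representing cocycle is principal there; with
trivial action principal means zero).
[cite: Howard2004HeegnerKolyvagin, §1.1 transverse condition and §1.2 (arXiv p. 5 L52–56, p. 6 L84–95)] -/
theorem oneCocycleClass_mem_transverseCondition_iff (ρ : DiscreteGaloisModule K M₁) (ℓ : ℕ)
    (jbar : AlgebraicClosure K →+* ℂ) (v : HeightOneSpectrum (𝓞 K))
    (htriv : ∀ g ∈ transverseFixer p ℓ jbar v, ∀ x : M₁, GaloisRep.toLocal v ρ g x = x)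
    (φ : contOneCocycles (DiscreteGaloisModule.toTopRep (GaloisRep.toLocal v ρ))) :
    oneCocycleClass _ φ ∈ transverseCondition p ρ ℓ jbar v ↔
      ∀ g ∈ transverseFixer p ℓ jbar v, φ.1 g = 0 := by
  have key := resSubgroup_oneCocycleClass_eq_zero_iff
    (DiscreteGaloisModule.toTopRep (GaloisRep.toLocal v ρ)) (transverseFixer p ℓ jbar v) φ
  refine Iff.trans Iff.rfl (key.trans ?_)
  constructor
  · rintro ⟨w, hw⟩ g hg
    rw [hw g hg, ContinuousRep.toTopRep_ρ_apply, htriv g hg, sub_self]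
  · intro h
    exact ⟨0, fun g hg => by rw [h g hg, map_zero, sub_zero]⟩

/-- **The transverse condition is cartesian along an injective morphism with trivial `Γ_L`-action**
(Lemma 1.5.1, the H.3 clause at a prime of `n`, [MR04, Lemma 3.7.4] in the trivial-action case):
for an additive, `Γ_{K_λ}`-equivariant, injective `f : M₁ → M₂` with `Γ_L` acting trivially on `M₂`,
`H¹(K_λ, f)⁻¹(H¹_tr(K_λ, M₂)) = H¹_tr(K_λ, M₁)` — both memberships read «the cocycle vanishes on `Γ_L`».
[cite: Howard2004HeegnerKolyvagin, Lemma 1.5.1 with Def. 1.1.2 (arXiv p. 9 L127–133, p. 5 L88–92)]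
[cite: MazurRubinMemoirs2004, Lemma 3.7.4] -/
theorem comap_cohomologyMap_transverseCondition_eq (ρ₁ : DiscreteGaloisModule K M₁)
    (ρ₂ : DiscreteGaloisModule K M₂) (ℓ : ℕ) (jbar : AlgebraicClosure K →+* ℂ)
    (v : HeightOneSpectrum (𝓞 K)) (f : M₁ →+ M₂) (hinj : Function.Injective f)
    (hf : ∀ (g : absoluteGaloisGroup (v.adicCompletion K)) (x : M₁),
      f (GaloisRep.toLocal v ρ₁ g x) = GaloisRep.toLocal v ρ₂ g (f x))
    (htriv : ∀ g ∈ transverseFixer p ℓ jbar v, ∀ y : M₂, GaloisRep.toLocal v ρ₂ g y = y) :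
    (transverseCondition p ρ₂ ℓ jbar v).comap
        (ContinuousRep.cohomologyMap (GaloisRep.toLocal v ρ₁) (GaloisRep.toLocal v ρ₂) f
          continuous_of_discreteTopology hf 1) =
      transverseCondition p ρ₁ ℓ jbar v := by
  have htriv₁ : ∀ g ∈ transverseFixer p ℓ jbar v, ∀ x : M₁, GaloisRep.toLocal v ρ₁ g x = x :=
    fun g hg x => hinj (by rw [hf, htriv g hg])
  ext c
  obtain ⟨z, rfl⟩ := oneCocycleClass_surjective _ c
  rw [AddSubgroup.mem_comap, cohomologyMap_one_oneCocycleClass]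
  refine (oneCocycleClass_mem_transverseCondition_iff ρ₂ ℓ jbar v htriv _).trans
    (Iff.trans (forall₂_congr fun g _ => ?_)
      (oneCocycleClass_mem_transverseCondition_iff ρ₁ ℓ jbar v htriv₁ z).symm)
  change f (z.1 g) = 0 ↔ z.1 g = 0
  exact map_eq_zero_iff _ hinj

/-- `F(n)` does not touch the archimedean places. [cite: Howard2004HeegnerKolyvagin, Def. 1.2.2 (arXiv p. 6 L101–125)] -/
theorem _root_.Literature.NumberTheory.GaloisCohomology.Howard2004.SelmerTriple.atLevel_cond_inl
    {ρ : DiscreteGaloisModule K M₁}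
    (t : SelmerTriple p ρ) (jbar : AlgebraicClosure K →+* ℂ) (n : Finset (HeightOneSpectrum (𝓞 K)))
    (w : InfinitePlace K) : (t.atLevel jbar n).cond (Sum.inl w) = t.cond (Sum.inl w) := rfl

end Transverse

/-! ## §2 Lemma 1.3.3 at level `n` on a `DVRSetting`: the levels `(k, k+1)` -/

namespace DVRSetting

variable {p : ℕ} [Fact p.Prime] {K : Type} [Field K] [NumberField K]
  {R : Type} [CommRing R] [IsDomain R] [IsDiscreteValuationRing R] [Algebra ℤ_[p] R]
  {N : ℕ → Type} [∀ k, AddCommGroup (N k)] [∀ k, TopologicalSpace (N k)]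
  [∀ k, DiscreteTopology (N k)] [∀ k, Module R (N k)]
  {Rk : ℕ → Type} [∀ k, CommRing (Rk k)] [∀ k, IsLocalRing (Rk k)] [∀ k, TopologicalSpace (Rk k)]
  [∀ k, DiscreteTopology (Rk k)] [∀ k, Algebra ℤ_[p] (Rk k)] [∀ k, Algebra R (Rk k)]
  [∀ k, Module (Rk k) (N k)] [∀ k, IsScalarTower R (Rk k) (N k)]
  {Nbar : Type} [AddCommGroup Nbar] [TopologicalSpace Nbar] [DiscreteTopology Nbar]
  [∀ k, Module (Rk k) Nbar]
  {Nq : ℕ → Finset (HeightOneSpectrum (𝓞 K)) → Type} [∀ k n, AddCommGroup (Nq k n)]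
  [∀ k n, TopologicalSpace (Nq k n)] [∀ k n, DiscreteTopology (Nq k n)]
  [∀ k n, Module (Rk k) (Nq k n)] [∀ k n, Module R (Nq k n)]
  [∀ k n, IsScalarTower R (Rk k) (Nq k n)]

/-- **(Cₙ) The one-step cartesian identity for `F(n)` at EVERY place:
`F(n)_{k,v} = H¹(K_v, inc_k)⁻¹(F(n)_{k+1,v})`** on a `DVRSetting` with H.0–H.5, for a finite set `n` of
primes of `𝓛` at which `Γ_L` acts trivially on `T^{(k+1)}` (hence on `T^{(k)}`): at `v ∈ n` both
conditions are transverse (§1), elsewhere `F(n) = F` and this is w2 g14's (C) `comap_incLoc_cond_eq`.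
[cite: Howard2004HeegnerKolyvagin, Lemma 1.5.1, Def. 1.2.2 and Lemma 1.3.3 (arXiv p. 9 L127–133, p. 6 L101–125, p. 7 L152–160)] -/
theorem comap_incLoc_atLevel_cond_eq (S : DVRSetting p K R N Rk Nbar Nq) (hy : S.SatisfiesH)
    (hπm : S.π ∈ IsLocalRing.maximalIdeal R) (hle : ∀ k, S.e k ≤ S.e (k + 1)) (k : ℕ)
    (n : Finset (HeightOneSpectrum (𝓞 K)))
    (htriv : ∀ w ∈ n, ∀ g ∈ transverseFixer p (residueChar w) S.jbar w, ∀ y : N (k + 1),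
      GaloisRep.toLocal w (S.T.ρ (k + 1)) g y = y)
    (v : Place K) :
    (((S.t (k + 1)).atLevel S.jbar n).cond v).comap
        (AdicTower.incLoc S.T S.π S.e hy.killed hy.ker_red hπm hle k v) =
      ((S.t k).atLevel S.jbar n).cond v := by
  rcases v with w | w
  · -- archimedean: `F(n) = F`
    rw [(S.t (k + 1)).atLevel_cond_inl, (S.t k).atLevel_cond_inl]
    exact S.comap_incLoc_cond_eq hy hπm hle k (Sum.inl w)
  · by_cases hw : w ∈ n
    · rw [(S.t (k + 1)).atLevel_cond_inr_of_mem S.jbar hw, (S.t k).atLevel_cond_inr_of_mem S.jbar hw]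
      exact comap_cohomologyMap_transverseCondition_eq (S.T.ρ k) (S.T.ρ (k + 1)) (residueChar w)
        S.jbar w (AdicTower.inc S.T S.π S.e hy.killed hy.ker_red hπm hle k).toAddMonoidHom
        (S.inc_injective hy hπm hle k)
        (fun _ x => AdicTower.inc_equivariant S.T S.π S.e hy.killed hy.ker_red hπm hle k _ x)
        (htriv w hw)
    · rw [(S.t (k + 1)).atLevel_cond_inr_of_not_mem S.jbar hw,
        (S.t k).atLevel_cond_inr_of_not_mem S.jbar hw]
      exact S.comap_incLoc_cond_eq hy hπm hle k (Sum.inr w)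

/-- **Selmer descent along `inc_k` for `F(n)`**: `H¹(K, inc_k) c ∈ H¹_{F(n)}(K, T^{(k+1)}) ↔
c ∈ H¹_{F(n)}(K, T^{(k)})` (localisation commutes with `H¹(inc_k)`, and (Cₙ)).
[cite: Howard2004HeegnerKolyvagin, Lemma 1.3.3 at level n (arXiv p. 7 L152–160, p. 12 L1–9)]
[cite: MazurRubinMemoirs2004, Lemma 3.5.4] -/
theorem incH1_mem_selmerGroup_atLevel_iff (S : DVRSetting p K R N Rk Nbar Nq) (hy : S.SatisfiesH)
    (hπm : S.π ∈ IsLocalRing.maximalIdeal R) (hle : ∀ k, S.e k ≤ S.e (k + 1)) (k : ℕ)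
    (n : Finset (HeightOneSpectrum (𝓞 K)))
    (htriv : ∀ w ∈ n, ∀ g ∈ transverseFixer p (residueChar w) S.jbar w, ∀ y : N (k + 1),
      GaloisRep.toLocal w (S.T.ρ (k + 1)) g y = y)
    (c : galoisCohomology (S.T.ρ k) 1) :
    S.T.incH1 S.π S.e hy.killed hy.ker_red hπm hle k c ∈
        (((S.t (k + 1)).atLevel S.jbar n).cond).selmerGroup ↔
      c ∈ (((S.t k).atLevel S.jbar n).cond).selmerGroup := by
  simp only [SelmerStructure.mem_selmerGroup_iff, AdicTower.localization_incH1]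
  refine forall_congr' fun v => ?_
  rw [← S.comap_incLoc_atLevel_cond_eq hy hπm hle k n htriv v, AddSubgroup.mem_comap]

/-- **Howard's Lemma 1.3.3 AT LEVEL `n`, levels `(k, k+1)`**: a class `c ∈ H¹(K, T^{(k+1)})` is an
`F(n)`-Selmer class killed by `π^{e_k}` iff `c = H¹(K, inc_k) c'` for an `F(n)`-Selmer class
`c' ∈ H¹_{F(n)}(K, T^{(k)})` — «`H¹_{F(n)}(K, T/𝔪^iT) ≅ H¹_{F(n)}(K, T)[𝔪^i]`» read on the tower, one step
((Z) of w2 g14 + the descent above).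
[cite: Howard2004HeegnerKolyvagin, Lemma 1.3.3 with Lemma 1.5.1, as used in Lemma 1.6.4 (arXiv p. 7 L152–160, p. 9 L127–133, p. 12 L1–9)]
[cite: MazurRubinMemoirs2004, Lemma 3.5.4] -/
theorem exists_mem_selmerGroup_atLevel_incH1_eq_iff (S : DVRSetting p K R N Rk Nbar Nq)
    (hy : S.SatisfiesH) (hπm : S.π ∈ IsLocalRing.maximalIdeal R) (hle : ∀ k, S.e k ≤ S.e (k + 1))
    (k : ℕ) (n : Finset (HeightOneSpectrum (𝓞 K)))
    (htriv : ∀ w ∈ n, ∀ g ∈ transverseFixer p (residueChar w) S.jbar w, ∀ y : N (k + 1),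
      GaloisRep.toLocal w (S.T.ρ (k + 1)) g y = y)
    (c : galoisCohomology (S.T.ρ (k + 1)) 1) :
    (∃ c' ∈ (((S.t k).atLevel S.jbar n).cond).selmerGroup,
        S.T.incH1 S.π S.e hy.killed hy.ker_red hπm hle k c' = c) ↔
      c ∈ (((S.t (k + 1)).atLevel S.jbar n).cond).selmerGroup ∧
        galoisCohomology.scalarMapH1 (S.T.ρ (k + 1)) (S.T.hlin (k + 1)) (S.π ^ S.e k) c = 0 := by
  constructor
  · rintro ⟨c', hc', rfl⟩
    refine ⟨(S.incH1_mem_selmerGroup_atLevel_iff hy hπm hle k n htriv c').2 hc', ?_⟩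
    have h0 : galoisCohomology.scalarMapH1 (S.T.ρ k) (S.T.hlin k) (S.π ^ S.e k) c' = 0 :=
      galoisCohomology.smul_eq_zero_of_forall (S.T.ρ k) (S.T.hlin k) _
        (fun m => hy.killed k _ (Ideal.pow_mem_pow hπm _) m) c'
    rw [← AdicTower.incH1_scalarMapH1, h0, map_zero]
  · rintro ⟨hc, h0⟩
    obtain ⟨c', rfl⟩ := S.exists_incH1_eq_of_scalarMapH1_pow_eq_zero hy hπm hle k c h0
    exact ⟨c', (S.incH1_mem_selmerGroup_atLevel_iff hy hπm hle k n htriv c').1 hc, rfl⟩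

/-! ## §3 Lemma 1.3.3 at level `n` through several levels (`i ≤ j`) -/

/-- **Selmer ascent/descent for `F(n)` through `d` levels**: `inc_{k→k+d} c₀ ∈ H¹_{F(n)}(K, T^{(k+d)}) ↔
c₀ ∈ H¹_{F(n)}(K, T^{(k)})`, for `n` a finite set of primes at which `Γ_L` acts trivially on the levels
`≤ m` (`k + d ≤ m`; print: `n ∈ 𝓝^{(m)}`). [cite: Howard2004HeegnerKolyvagin, Lemma 1.3.3 with Lemma 1.5.1 (arXiv p. 7 L152–160, p. 9 L127–133, p. 12 L1–9)] [cite: MazurRubinMemoirs2004, Lemma 3.5.4] -/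
theorem incH1LE_mem_selmerGroup_atLevel_iff (S : DVRSetting p K R N Rk Nbar Nq) (hy : S.SatisfiesH)
    (hπm : S.π ∈ IsLocalRing.maximalIdeal R) (hle : ∀ k, S.e k ≤ S.e (k + 1))
    (n : Finset (HeightOneSpectrum (𝓞 K))) (m : ℕ)
    (htriv : ∀ j, j ≤ m → ∀ w ∈ n, ∀ g ∈ transverseFixer p (residueChar w) S.jbar w, ∀ y : N j,
      GaloisRep.toLocal w (S.T.ρ j) g y = y)
    (k : ℕ) :
    ∀ (d : ℕ), k + d ≤ m → ∀ c : galoisCohomology (S.T.ρ k) 1,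
      AdicTower.incH1LE S.T S.π S.e hy.killed hy.ker_red hπm hle k (k + d) (Nat.le_add_right k d) c ∈
          (((S.t (k + d)).atLevel S.jbar n).cond).selmerGroup ↔
        c ∈ (((S.t k).atLevel S.jbar n).cond).selmerGroup
  | 0, _, c => by
      have h0 : AdicTower.incH1LE S.T S.π S.e hy.killed hy.ker_red hπm hle k k le_rfl = AddMonoidHom.id _ :=
        Nat.leRec_self _ _
      change AdicTower.incH1LE S.T S.π S.e hy.killed hy.ker_red hπm hle k k le_rfl c ∈
          (((S.t k).atLevel S.jbar n).cond).selmerGroup ↔ _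
      rw [h0, AddMonoidHom.id_apply]
  | d + 1, hdm, c => by
      have h2 : AdicTower.incH1LE S.T S.π S.e hy.killed hy.ker_red hπm hle k (k + d + 1)
            (Nat.le_add_right k (d + 1)) =
          (S.T.incH1 S.π S.e hy.killed hy.ker_red hπm hle (k + d)).comp
            (AdicTower.incH1LE S.T S.π S.e hy.killed hy.ker_red hπm hle k (k + d) (Nat.le_add_right k d)) :=
        Nat.leRec_succ _ _ (Nat.le_add_right k d)
      change AdicTower.incH1LE S.T S.π S.e hy.killed hy.ker_red hπm hle k (k + d + 1)
          (Nat.le_add_right k (d + 1)) c ∈ (((S.t (k + d + 1)).atLevel S.jbar n).cond).selmerGroup ↔ _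
      rw [h2, AddMonoidHom.comp_apply,
        S.incH1_mem_selmerGroup_atLevel_iff hy hπm hle (k + d) n (htriv (k + d + 1) hdm),
        S.incH1LE_mem_selmerGroup_atLevel_iff hy hπm hle n m htriv k d (Nat.le_of_succ_le hdm) c]

/-- **Descent for `F(n)` through `d` levels**: an `F(n)`-Selmer class of `H¹(K, T^{(k+d)})` killed by
`π^{e_k}` is `inc_{k→k+d} c₀` for an `F(n)`-Selmer class `c₀ ∈ H¹_{F(n)}(K, T^{(k)})` — Lemma 1.3.3 at
level `n`, «`H¹_{F(n)}(K,T^{(k)}) ≅ H¹_{F(n)}(K,T^{(2k-1)})[𝔪^k]`» (arXiv p. 11 L72–74, p. 12 L1–2), on the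
tower (`k + d ≤ m`, `Γ_L` trivial on the levels `≤ m` at the primes of `n`).
[cite: Howard2004HeegnerKolyvagin, Lemma 1.3.3 with Lemma 1.5.1, Lemma 1.6.3/1.6.4 proofs (arXiv p. 7 L152–160, p. 11 L72–74, p. 12 L1–9)] [cite: MazurRubinMemoirs2004, Lemma 3.5.4] -/
theorem exists_mem_selmerGroup_atLevel_incH1LE_eq (S : DVRSetting p K R N Rk Nbar Nq) (hy : S.SatisfiesH)
    (hπm : S.π ∈ IsLocalRing.maximalIdeal R) (hle : ∀ k, S.e k ≤ S.e (k + 1))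
    (n : Finset (HeightOneSpectrum (𝓞 K))) (m : ℕ)
    (htriv : ∀ j, j ≤ m → ∀ w ∈ n, ∀ g ∈ transverseFixer p (residueChar w) S.jbar w, ∀ y : N j,
      GaloisRep.toLocal w (S.T.ρ j) g y = y)
    (k : ℕ) :
    ∀ (d : ℕ), k + d ≤ m → ∀ c : galoisCohomology (S.T.ρ (k + d)) 1,
      c ∈ (((S.t (k + d)).atLevel S.jbar n).cond).selmerGroup →
      galoisCohomology.scalarMapH1 (S.T.ρ (k + d)) (S.T.hlin (k + d)) (S.π ^ S.e k) c = 0 →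
        ∃ c₀ ∈ (((S.t k).atLevel S.jbar n).cond).selmerGroup,
          AdicTower.incH1LE S.T S.π S.e hy.killed hy.ker_red hπm hle k (k + d) (Nat.le_add_right k d) c₀ = c
  | 0, _, c, hc, _ => ⟨c, hc, by
      have h0 : AdicTower.incH1LE S.T S.π S.e hy.killed hy.ker_red hπm hle k k le_rfl = AddMonoidHom.id _ :=
        Nat.leRec_self _ _
      exact (DFunLike.congr_fun h0 c).trans rfl⟩
  | d + 1, hdm, c, hc, h0 => by
    change c ∈ (((S.t (k + d + 1)).atLevel S.jbar n).cond).selmerGroup at hc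
    change galoisCohomology.scalarMapH1 (S.T.ρ (k + d + 1)) (S.T.hlin (k + d + 1)) (S.π ^ S.e k) c = 0
      at h0
    change ∃ c₀ ∈ (((S.t k).atLevel S.jbar n).cond).selmerGroup,
      AdicTower.incH1LE S.T S.π S.e hy.killed hy.ker_red hπm hle k (k + d + 1)
        (Nat.le_add_right k (d + 1)) c₀ = c
    have hkd : S.e k ≤ S.e (k + d) := hy.e_strictMono.monotone (Nat.le_add_right k d)
    have h0' : galoisCohomology.scalarMapH1 (S.T.ρ (k + d + 1)) (S.T.hlin (k + d + 1))
        (S.π ^ S.e (k + d)) c = 0 := by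
      rw [← Nat.sub_add_cancel hkd, pow_add, galoisCohomology.scalarMapH1_mul, AddMonoidHom.comp_apply,
        h0, map_zero]
    obtain ⟨c₁, hc₁, rfl⟩ := (S.exists_mem_selmerGroup_atLevel_incH1_eq_iff hy hπm hle (k + d) n
      (htriv (k + d + 1) hdm) c).2 ⟨hc, h0'⟩
    have h1 : galoisCohomology.scalarMapH1 (S.T.ρ (k + d)) (S.T.hlin (k + d)) (S.π ^ S.e k) c₁ = 0 := by
      apply S.incH1_injective hy hπm hle (k + d)
      rw [AdicTower.incH1_scalarMapH1, h0, map_zero]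
    obtain ⟨c₀, hc₀, rfl⟩ := S.exists_mem_selmerGroup_atLevel_incH1LE_eq hy hπm hle n m htriv k d
      (Nat.le_of_succ_le hdm) c₁ hc₁ h1
    refine ⟨c₀, hc₀, ?_⟩
    have h2 : AdicTower.incH1LE S.T S.π S.e hy.killed hy.ker_red hπm hle k (k + d + 1)
          (Nat.le_add_right k (d + 1)) =
        (S.T.incH1 S.π S.e hy.killed hy.ker_red hπm hle (k + d)).comp
          (AdicTower.incH1LE S.T S.π S.e hy.killed hy.ker_red hπm hle k (k + d) (Nat.le_add_right k d)) :=
      Nat.leRec_succ _ _ (Nat.le_add_right k d)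
    rw [h2, AddMonoidHom.comp_apply]

/-! ## §4 Discharging the trivial-action hypothesis at a level killed by `I_n` -/

/-- **At `w ∈ n ∈ 𝓝(𝓛)`, `Γ_{K_w}` acts trivially on a level `T^{(j)}` killed by `I_n`** (i.e. whose
presentation `T^{(j)} ↠ T^{(j)}/I_nT^{(j)}` of the `LevelData` is injective): on `T^{(j)}/I_n` the
Frobenius elements at `w` act trivially under H.0 (`Frob_w ≡ 1 mod I_w ⊆ I_n`,
`LevelData.ρq_apply_eq_self_of_h0`), hence all of `Γ_{K_w}` does (`w ∈ 𝓛` unramified, stabilisers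
closed: lit's `trivial_toLocal_of_mem_primes`), and the presentation is an equivariant injection.
This discharges the hypothesis `htriv` of §2–§3 at the levels `j` with `I_n T^{(j)} = 0` (print:
`n ∈ 𝓝^{(k)}`, `j ≤ k`). [cite: Howard2004HeegnerKolyvagin, Def. 1.2.1, §1.5 standing hypothesis `𝓛 ⊂ 𝓛_k(T)` and §1.6 `𝓝^{(k)}` (arXiv p. 6 L63–75, p. 9 L100–104, p. 11 L33–38)] -/
theorem toLocal_apply_eq_self_of_ker_eq_bot (S : DVRSetting p K R N Rk Nbar Nq) (hy : S.SatisfiesH)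
    (j : ℕ) {n : Finset (HeightOneSpectrum (𝓞 K))} (hn : n ∈ (S.t j).levelSet)
    (hker : LinearMap.ker ((S.LD j).π n) = ⊥)
    {w : HeightOneSpectrum (𝓞 K)} (hw : w ∈ n) (g : absoluteGaloisGroup (w.adicCompletion K))
    (y : N j) : GaloisRep.toLocal w (S.T.ρ j) g y = y := by
  have h1 : GaloisRep.toLocal w ((S.LD j).ρq n) g ((S.LD j).π n y) = (S.LD j).π n y :=
    trivial_toLocal_of_mem_primes (S.LD j) (hn hw)
      (fun σ hσ x => (S.LD j).ρq_apply_eq_self_of_h0 (hy.h0 j) hw hσ x) g _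
  have h2 : (S.LD j).π n (GaloisRep.toLocal w (S.T.ρ j) g y) = (S.LD j).π n y := by
    rw [GaloisRep.toLocal_apply, ((S.LD j).isQuotientBy n).equivariant]
    exact h1
  have h3 : GaloisRep.toLocal w (S.T.ρ j) g y - y ∈ LinearMap.ker ((S.LD j).π n) := by
    rw [LinearMap.mem_ker, map_sub, h2, sub_self]
  rw [hker, Submodule.mem_bot, sub_eq_zero] at h3
  exact h3

/-- The same from «`I_n` kills `T^{(j)}`» stated on the ideal: `I_n · T^{(j)} = 0`.
[cite: Howard2004HeegnerKolyvagin, Def. 1.2.1 and §1.6 (arXiv p. 6 L63–75, p. 11 L33–38)] -/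
theorem toLocal_apply_eq_self_of_levelIdeal_smul_eq_bot (S : DVRSetting p K R N Rk Nbar Nq)
    (hy : S.SatisfiesH) (j : ℕ) {n : Finset (HeightOneSpectrum (𝓞 K))} (hn : n ∈ (S.t j).levelSet)
    (hI : levelIdeal (R := Rk j) (S.T.ρ j) n • (⊤ : Submodule (Rk j) (N j)) = ⊥)
    {w : HeightOneSpectrum (𝓞 K)} (hw : w ∈ n) (g : absoluteGaloisGroup (w.adicCompletion K))
    (y : N j) : GaloisRep.toLocal w (S.T.ρ j) g y = y :=
  S.toLocal_apply_eq_self_of_ker_eq_bot hy j hn (by rw [((S.LD j).isQuotientBy n).ker_eq, hI]) hw g y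

/-- **The hypothesis `htriv` of §2–§3, discharged**: if `I_n` kills the levels `j ≤ m`, then `Γ_L`
(indeed `Γ_{K_w}`) acts trivially on them at every `w ∈ n`.
[cite: Howard2004HeegnerKolyvagin, §1.6 `n ∈ 𝓝^{(k)}` (arXiv p. 11 L33–38)] -/
theorem htriv_of_levelIdeal_smul_eq_bot (S : DVRSetting p K R N Rk Nbar Nq) (hy : S.SatisfiesH)
    {n : Finset (HeightOneSpectrum (𝓞 K))} (m : ℕ)
    (hn : ∀ j, j ≤ m → n ∈ (S.t j).levelSet)
    (hI : ∀ j, j ≤ m → levelIdeal (R := Rk j) (S.T.ρ j) n • (⊤ : Submodule (Rk j) (N j)) = ⊥) :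
    ∀ j, j ≤ m → ∀ w ∈ n, ∀ g ∈ transverseFixer p (residueChar w) S.jbar w, ∀ y : N j,
      GaloisRep.toLocal w (S.T.ρ j) g y = y :=
  fun j hj _ hw g _ y => S.toLocal_apply_eq_self_of_levelIdeal_smul_eq_bot hy j (hn j hj) (hI j hj) hw g y

end DVRSetting

end Literature.NumberTheory.GaloisCohomology.Howard2004

end
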